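import Summits.Ventures.LatticeQCDFlow.Scoring.SU2TorusPolyakovLoops
import HarnessLib

/-!
# SU(2) on the 2-torus: THE POLYAKOV LOOP IS EXACTLY UNCORRELATED WITH EVERY PLAQUETTE — `⟨½ tr U_{x₀} · ½ tr P_j⟩_{(ℤ/L)²,β} = 0`

HONEST FRAMING: exact (Metropolis-corrected) sampling algorithms for lattice gauge theory;
figures of merit are autocorrelation/cost numbers at stated couplings and volumes; no
continuum-physics claim.

Venture `LatticeQCDFlow` (cell pub-lqcd), sub-topic `Scoring`; FANOUT row 5 (`s0-sun-a`), GEN-12.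
NEW WORK of the cell (placement rule); a corollary of GEN-11's `SU2TorusPolyakovLoopCharacterIntegral`
(`∫ a₀(P_j) ∏_x χ_{m_x}(U_x) dHaar^{⊗E} = 0` for EVERY assignment `m`) and GEN-10's insertion rule
(`a₀(U_{x₀}) ∏ χ_m = ½ ∏ χ_{m⁺} + ½[m_{x₀} ≠ 0] ∏ χ_{m⁻}`):

* **`wilson_mean_su2a0_plaquette_mul_polyakov_two`** — for every `L ≥ 1`, `β ≥ 0`, plaquette `x₀` and
  Polyakov line `P_j` (base point `(i, j)`): `⟨½ tr U_{x₀} · ½ tr P_j⟩_{(ℤ/L)²,β} = 0`.  With `⟨½ tr P_j⟩ = 0`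
  (`wilson_mean_su2a0_polyakov_two`): the covariance of the Polyakov loop with any plaquette vanishes
  identically — centre symmetry (`h ↦ −h` on one row of temporal links flips `tr P` and fixes every
  plaquette) as an exact identity of the finite-volume Haar-based measure.  For the samplers: the plaquette
  carries no information about the Polyakov-loop sector, at any `β` and `L`.

Nothing is cited; no `def`.
-/

noncomputable section

open Real MeasureTheory Set Function Finset Polynomial.Chebyshev
open Literature.MathematicalPhysics.QuantumFieldTheory Literature.MathematicalPhysics.QuantumLattice
open Literature.Analysis.FunctionSpaces
open Summit.Ventures.LatticeQCDFlow.Exactness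
open Summit.Ventures.LatticeQCDFlow.Theory2.Lattice

namespace Summit.Ventures.LatticeQCDFlow.Scoring

variable {L : ℕ} [NeZero L]

/-- **`∫ a₀(U_{x₀}) a₀(P_j) ∏_x χ_{m_x}(U_x) dHaar^{⊗E} = 0`** for every assignment `m`: insert the plaquette
trace (`m ↦ m^±`) and apply the vanishing of the Polyakov insertion for `m⁺` and `m⁻`. -/
theorem integral_su2a0_plaquette_mul_polyakov_mul_prod_su2Character (x₀ : Site 2 L) (i j : ZMod L)
    (m : Site 2 L → ℕ) :
    ∫ V, su2a0 (((List.range L).map fun a : ℕ => V (![i + a, j], 0)).prod) *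
        (su2a0 (plaquetteHolonomy V x₀ 0 1) *
          ∏ x : Site 2 L, (U ℝ (m x)).eval (su2a0 (plaquetteHolonomy V x 0 1)))
        ∂(Measure.pi fun _ : Edge 2 L => haarProbability (Matrix.specialUnitaryGroup (Fin 2) ℂ)) = 0 := by
  simp_rw [su2a0_mul_prod_su2Character (fun (x : Site 2 L)
    (V : GaugeConfig 2 L (Matrix.specialUnitaryGroup (Fin 2) ℂ)) => su2a0 (plaquetteHolonomy V x 0 1)) m x₀]
  have hcP : Continuous fun V : GaugeConfig 2 L (Matrix.specialUnitaryGroup (Fin 2) ℂ) =>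
      su2a0 (((List.range L).map fun a : ℕ => V (![i + (a : ZMod L), j], 0)).prod) :=
    continuous_su2a0.comp (continuous_rowProd i j L)
  have hi : ∀ m' : Site 2 L → ℕ, Integrable (fun V : GaugeConfig 2 L (Matrix.specialUnitaryGroup (Fin 2) ℂ) =>
      su2a0 (((List.range L).map fun a : ℕ => V (![i + (a : ZMod L), j], 0)).prod) *
        ∏ x : Site 2 L, (U ℝ (m' x)).eval (su2a0 (plaquetteHolonomy V x 0 1)))
      (Measure.pi fun _ : Edge 2 L => haarProbability (Matrix.specialUnitaryGroup (Fin 2) ℂ)) := fun m' =>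
    integrable_pi_su2_of_continuous (ι := Edge 2 L) (hcP.mul (continuous_prod_su2Character_plaquettes m'))
  by_cases h0 : m x₀ = 0
  · simp_rw [if_pos h0, mul_zero, add_zero]
    have : ∀ V : GaugeConfig 2 L (Matrix.specialUnitaryGroup (Fin 2) ℂ),
        su2a0 (((List.range L).map fun a : ℕ => V (![i + (a : ZMod L), j], 0)).prod) *
          ((1 / 2) * ∏ x : Site 2 L, (U ℝ (update m x₀ (m x₀ + 1) x)).eval (su2a0 (plaquetteHolonomy V x 0 1))) =
        (1 / 2) * (su2a0 (((List.range L).map fun a : ℕ => V (![i + (a : ZMod L), j], 0)).prod) *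
          ∏ x : Site 2 L, (U ℝ (update m x₀ (m x₀ + 1) x)).eval (su2a0 (plaquetteHolonomy V x 0 1))) :=
      fun V => by ring
    simp_rw [this]
    rw [integral_const_mul, integral_su2a0_polyakov_mul_prod_su2Character, mul_zero]
  · simp_rw [if_neg h0]
    have : ∀ V : GaugeConfig 2 L (Matrix.specialUnitaryGroup (Fin 2) ℂ),
        su2a0 (((List.range L).map fun a : ℕ => V (![i + (a : ZMod L), j], 0)).prod) *
          ((1 / 2) * ∏ x : Site 2 L, (U ℝ (update m x₀ (m x₀ + 1) x)).eval (su2a0 (plaquetteHolonomy V x 0 1)) +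
            (1 / 2) * ∏ x : Site 2 L, (U ℝ (update m x₀ (m x₀ - 1) x)).eval (su2a0 (plaquetteHolonomy V x 0 1))) =
        (1 / 2) * (su2a0 (((List.range L).map fun a : ℕ => V (![i + (a : ZMod L), j], 0)).prod) *
          ∏ x : Site 2 L, (U ℝ (update m x₀ (m x₀ + 1) x)).eval (su2a0 (plaquetteHolonomy V x 0 1))) +
        (1 / 2) * (su2a0 (((List.range L).map fun a : ℕ => V (![i + (a : ZMod L), j], 0)).prod) *
          ∏ x : Site 2 L, (U ℝ (update m x₀ (m x₀ - 1) x)).eval (su2a0 (plaquetteHolonomy V x 0 1))) :=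
      fun V => by ring
    simp_rw [this]
    rw [integral_add ((hi _).const_mul _) ((hi _).const_mul _), integral_const_mul, integral_const_mul,
      integral_su2a0_polyakov_mul_prod_su2Character, integral_su2a0_polyakov_mul_prod_su2Character]
    ring

omit [NeZero L] in
/-- The product of a Polyakov line trace and a plaquette trace is continuous. -/
theorem continuous_polyakov_mul_plaquette (x₀ : Site 2 L) (i j : ZMod L) :
    Continuous fun V : GaugeConfig 2 L (Matrix.specialUnitaryGroup (Fin 2) ℂ) =>
      su2a0 (((List.range L).map fun a : ℕ => V (![i + a, j], 0)).prod) * su2a0 (plaquetteHolonomy V x₀ 0 1) :=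
  (continuous_su2a0.comp (continuous_rowProd i j L)).mul
    (continuous_su2a0.comp (by unfold plaquetteHolonomy; fun_prop))

/-- **THE POLYAKOV LOOP IS EXACTLY UNCORRELATED WITH EVERY PLAQUETTE.**  For every `L ≥ 1`, `β ≥ 0`,
plaquette `x₀` and Polyakov line `P_j = h(i,j)⋯h(i+L−1,j)` of `(ℤ/L)²`, under theory-2's Wilson measure:
`⟨½ tr P_j · ½ tr U_{x₀}⟩_{(ℤ/L)²,β} = 0` (and `⟨½ tr P_j⟩ = 0`, `SU2TorusPolyakovLoops`): centre symmetry as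
an exact identity of the finite-volume measure. -/
theorem wilson_mean_su2a0_plaquette_mul_polyakov_two {β : ℝ} (hβ : 0 ≤ β) (x₀ : Site 2 L) (i j : ZMod L) :
    ∫ V, su2a0 (((List.range L).map fun a : ℕ => V (![i + a, j], 0)).prod) * su2a0 (plaquetteHolonomy V x₀ 0 1)
        ∂(wilsonMeasure (d := 2) (L := L) (fundamentalRep (Fin 2)) β) = 0 := by
  haveI := secondCountableTopology_su2
  rw [integral_wilsonMeasure_su2_eq_div,
    (integral_obs_mul_exp_neg_wilsonAction_eq_tsum hβ
      (fun V : GaugeConfig 2 L (Matrix.specialUnitaryGroup (Fin 2) ℂ) =>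
        su2a0 (((List.range L).map fun a : ℕ => V (![i + (a : ZMod L), j], 0)).prod) *
          su2a0 (plaquetteHolonomy V x₀ 0 1))
      (continuous_polyakov_mul_plaquette x₀ i j).measurable (fun V => by
        rw [abs_mul]
        exact mul_le_one₀ (abs_su2a0_le_one _) (abs_nonneg _) (abs_su2a0_le_one _))).2]
  have hterm : ∀ x : Plaquette 2 L → ℕ,
      (∏ p, Real.exp (-(2 * β)) * (besselI (x p) (2 * β) - besselI (x p + 2) (2 * β))) *
        ∫ V, su2a0 (((List.range L).map fun a : ℕ => V (![i + a, j], 0)).prod) *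
            su2a0 (plaquetteHolonomy V x₀ 0 1) *
          ∏ p : Plaquette 2 L, (U ℝ (x p)).eval (su2a0 (plaquetteHolonomy V p.1 p.2.1.1 p.2.1.2))
          ∂(Measure.pi fun _ : Edge 2 L => haarProbability (Matrix.specialUnitaryGroup (Fin 2) ℂ)) = 0 := by
    intro x
    have hint : (fun V : GaugeConfig 2 L (Matrix.specialUnitaryGroup (Fin 2) ℂ) =>
        su2a0 (((List.range L).map fun a : ℕ => V (![i + a, j], 0)).prod) *
            su2a0 (plaquetteHolonomy V x₀ 0 1) *
          ∏ p : Plaquette 2 L, (U ℝ (x p)).eval (su2a0 (plaquetteHolonomy V p.1 p.2.1.1 p.2.1.2))) =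
        fun V => su2a0 (((List.range L).map fun a : ℕ => V (![i + a, j], 0)).prod) *
          (su2a0 (plaquetteHolonomy V x₀ 0 1) *
            ∏ s : Site 2 L, (U ℝ ((fun s : Site 2 L => x (s, ⟨((0 : Fin 2), (1 : Fin 2)), by decide⟩)) s)).eval
              (su2a0 (plaquetteHolonomy V s 0 1))) := by
      funext V
      rw [prod_plaquette_two, mul_assoc]
    rw [hint, integral_su2a0_plaquette_mul_polyakov_mul_prod_su2Character, mul_zero]
  simp_rw [hterm]
  rw [tsum_zero, zero_div]

end Summit.Ventures.LatticeQCDFlow.Scoring
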